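/-
Copyright (c) 2026 the pub-hodgecm-mathlib formalisation cell (harness21).  Prover seat hodgecm-mathlib-B-p14 (g32) — heir of the (R2) glue
(B-p14 (g31) ★ p842588 ∕ p842603 ∕ p842953), on EP pen B-p04 (g34)'s HANDOFF `HANDOFF-R2EP-TypeOneE-assembly.B-p04g34.md` §3 (brick (R5c)),
2026-09-01.  FILE (R5c) of the Euler–Poincaré road for `stub_N6nsR2EP : RankOneEulerPoincareNonsplit`: the TYPE-(1) ELLIPTIC RELATION `(E)` on the
CM carrier `U₂ = U(Φ₂)(L⁺_v)`, in hypothesis form.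
-/
import Literature.NumberTheory.Automorphic.UnitaryTwoIwahoriEdgeCountCM                 -- ★ (B-p04, R5b) `natCard_fixedBy_iwahori_add_one_eq_sum_at`, `natCard_fixedBy_glInt_eq_ncard_selfDualStable_at`
import Literature.NumberTheory.Automorphic.UnitaryOrbitalIntegralSimilitudeFixedPoints   -- ★ (B-p10) `natCard_fixedBy_quotient_eq_natCard_fixedBy_quotient_cmDatumLocalNonsplitCongr_symm`, `coe_localNonsplitEquiv_cmDatumLocalNonsplitCongr_symm`
import HarnessLib

/-!
# Kottwitz's type-(1) elliptic relation on `U(Φ₂)(L⁺_v)`: `#Fix(U₂⧸K, γ) + #Fix(U₂⧸K′, γ) = #Fix(U₂⧸I, γ) + 1`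

Topic `NumberTheory/Automorphic`, namespace `Literature.NumberTheory.Automorphic.UnitaryGroup`.  THEOREMS ONLY: no definition, no named fact, no
instance, no notation, no `sorry`; kernel lane.  Brick (R5c) of the (R2) Euler–Poincaré road (EP pen B-p04 (g34)'s handoff §3): the elliptic binder
`hE` of the glue ★ `Rogawski1990.exists_isLocSmooth_classOrbitalIntegral_eq_one_zero_of_relations_two` for TYPE-(1) regular elliptic classes, read on
the CM carrier `U₂ := U(Φ₂)(L⁺_v) = (cmDatum L 2 Φ₂).Local v` through the one-place model `e_w : U₂ ≃ₜ* U_w = U(σ_w, (Φ₂)_w)(L_w)`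
(★ `localNonsplitEquiv`).

THE MATHEMATICS.  `L` CM, `v` a finite place of `L⁺` UNRAMIFIED and NON-SPLIT in `L`, `w ∣ v` (`c • w = w`), `σ_w`, `ϖ ∈ L_w^×` a `σ_w`-fixed
uniformiser (`|ϖ| = exp(−1)`), `d = diag(1, ϖ) ∈ GL₂(L_w)` (a similitude of `(Φ₂)_w` with multiplier `ϖ`, ★ `formCongr_glDiagonal_one_eq_smul_placeForm_antidiag`),
`q_v = |𝓞_{L⁺} ∕ v|`.  Kottwitz's Euler–Poincaré function of `U₂` [Kottwitz1988, §2] has the three levels `K` (stabiliser of the self-dual vertex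
`𝒪_w²`: `u ∈ K ↔ u_w ∈ GL₂(𝒪_w)`), `K′ = Ad_d K` (stabiliser of the `ϖ`-modular vertex: `u ∈ K′ ↔ u_w ∈ d GL₂(𝒪_w) d⁻¹`) and the Iwahori `I`
(`u ∈ I ↔ u_w ∈ iwahoriGL 2 L_w`); this file takes ANY three subgroups `C, C′, I ≤ U₂` with these one-place membership characterisations (the
shape of ★ B-p10 `epNonEllipticRelation_of_mem_iff`, the non-elliptic binder `hN`).  For a TYPE-(1) regular elliptic `γ ∈ U₂` — `γ_w P = P diag(u₀, u₁)`
over `L_w`, `u₀ ≠ u₁` of norm one, `|u₀ − u₁| = |ϖ_w^N|` — the fixed-point counts on the tree of `U(1,1)` satisfy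
**`V_K(γ) + V_{K′}(γ) = E(γ) + 1`**, i.e. `χ(X^γ) = 1` [Kottwitz1988, §2 Theorem 2], [Rogawski1990, §12.6 p. 174, Lemma 12.7.1].
PROOF (all inputs ★).  (a) `E(γ) + 1 = Σ_{j ≤ N} w(q_v, j)` (`w(0) = 1`, `w(j) = q^{j−1}(q+1)`) is ★ B-p04 `natCard_fixedBy_iwahori_add_one_eq_sum_at` at
`γ_w = e_w γ`, transported to `U₂ ⧸ I` by ★ `natCard_fixedBy_quotient_congr`.  (b) `V_K(γ) = #S((Φ₂)_w, γ_w) = Σ_{j ≤ N, j ≡ e₀} w` with the parity bit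
`e₀` of `ord ⟨p₀, p₀⟩` (★ `natCard_fixedBy_glInt_eq_ncard_selfDualStable_at`, ★ B-p10 (L5) `exists_ncard_selfDualStable_antidiagTwo_eq_zpow_smul_one` +
`ncard_selfDualStable_zpow_smul_one_eq_sum_at`).  (c) `V_{K′}(γ) = #Fix(U₂ ⧸ C, e_d⁻¹ γ)` (★ B-p10 similitude transport
`natCard_fixedBy_quotient_eq_natCard_fixedBy_quotient_cmDatumLocalNonsplitCongr_symm`), and `(e_d⁻¹ γ)_w = d⁻¹ γ_w d` has the eigenframe `d⁻¹ P` with the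
SAME `u`, so (b) gives `Σ_{j ≤ N, j ≡ e₁} w` with `e₁` the parity of `ord ⟨d⁻¹p₀, d⁻¹p₀⟩ = ord ⟨p₀, p₀⟩ − 1` (`ᵗ(σ d⁻¹) Φ₂ d⁻¹ = ϖ⁻¹ Φ₂`): THE PARITY
FLIPS, `e₁ = 1 − e₀`.  (d) `Σ_{j ≡ e₀} + Σ_{j ≢ e₀} = Σ_{j ≤ N}` and (a).
HONEST LABEL: HC_CM is proved only modulo the cell's remaining named inputs (hLiu418, h413) until rung 0 closes; this file is unconditional.

## References
* [Kottwitz1988] R. E. Kottwitz, *Tamagawa numbers*, Ann. of Math. 127 (1988), 629–646, §2 Theorem 2 (`O_γ(f_EP) = χ(X^γ) = 1` for elliptic `γ`).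
* [Rogawski1990] J. D. Rogawski, *Automorphic Representations of Unitary Groups in Three Variables* (1990), §12.6–12.7 pp. 174–176 (Lemma 12.7.1).
* [Serre1980Trees] J.-P. Serre, *Trees* (1980), Ch. II §1.1 (the tree of a rank-one group; vertices of two colours, edges = Iwahori cosets).
-/

set_option autoImplicit false

noncomputable section

open scoped ValuativeRel Matrix MatrixGroups
open Matrix ValuativeRel Finset IsLocalRing NumberField IsDedekindDomain MulAction

namespace Literature.NumberTheory.Automorphic

/-! ## §1 Bookkeeping: the parity classes of `range (N+1)` and the Gram entry under a diagonal rescaling -/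

/-- The two parity classes exhaust `range (N + 1)`: `Σ_{j ≡ e} f + Σ_{j ≡ 1−e} f = Σ f` for `e ≤ 1`. [cite: Kottwitz1988, §2] -/
theorem sum_filter_mod_two_add_sum_filter_one_sub_eq {M : Type*} [AddCommMonoid M] (f : ℕ → M) {e : ℕ} (he : e ≤ 1) (N : ℕ) :
    (∑ j ∈ (range (N + 1)).filter (fun j => j % 2 = e), f j) + ∑ j ∈ (range (N + 1)).filter (fun j => j % 2 = 1 - e), f j =
      ∑ j ∈ range (N + 1), f j := by
  rw [← Finset.sum_filter_add_sum_filter_not (range (N + 1)) (fun j => j % 2 = e) f]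
  congr 1
  refine Finset.sum_congr (Finset.filter_congr fun j _ => ?_) fun _ _ => rfl
  omega

/-- **`ᵗ(σ D) · antidiag(1,1) · D = (d₀ d₁) • antidiag(1,1)`** for a `σ`-fixed diagonal `D = diag(d₀, d₁)`. [cite: Rogawski1990, §3.1 p. 19] -/
theorem twistGram_antidiag_diagonal_of_map_eq {K : Type*} [CommRing K] (σ : K →+* K) (d : Fin 2 → K) (hd : ∀ i, σ (d i) = d i) :
    Rogawski1990.twistGram σ !![(0 : K), 1; 1, 0] (diagonal d) = (d 0 * d 1) • !![(0 : K), 1; 1, 0] := by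
  ext i j
  fin_cases i <;> fin_cases j <;>
    simp [Rogawski1990.twistGram_def, Matrix.mul_apply, Fin.sum_univ_two, Matrix.diagonal, hd, mul_comm]

/-- **The `(0,0)` Gram entry under a `σ`-fixed diagonal rescaling of the frame**: `⟨D p₀, D p₀⟩ = d₀ d₁ ⟨p₀, p₀⟩` on `(antidiag(1,1))`-space, i.e.
`(H_{D P})₀₀ = d₀ d₁ (H_P)₀₀` (★ `twistGram_mul`). [cite: Rogawski1990, §3.1 p. 19] -/
theorem twistGram_antidiag_diagonal_mul_apply_zero_zero {K : Type*} [CommRing K] (σ : K →+* K) (d : Fin 2 → K) (hd : ∀ i, σ (d i) = d i)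
    (P : Matrix (Fin 2) (Fin 2) K) :
    Rogawski1990.twistGram σ !![(0 : K), 1; 1, 0] (diagonal d * P) 0 0 = d 0 * d 1 * Rogawski1990.twistGram σ !![(0 : K), 1; 1, 0] P 0 0 := by
  rw [Rogawski1990.twistGram_mul, twistGram_antidiag_diagonal_of_map_eq σ d hd, Matrix.mul_smul, Matrix.smul_mul, Matrix.smul_apply,
    ← Rogawski1990.twistGram_def, smul_eq_mul]

/-- **Dividing by a uniformiser flips the parity of the order**: `|ϖ| = exp(−1)`, `x ≠ 0` ⇒ (`ord(ϖ⁻¹ x)` even ↔ `ord x` odd).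
[cite: Kottwitz1988, §2] -/
theorem even_log_valued_inv_mul_iff {F : Type*} [Field F] [Valued F (WithZero (Multiplicative ℤ))] {ϖ x : F} (hϖ : Valued.v ϖ = WithZero.exp (-1 : ℤ)) (hx : x ≠ 0) :
    Even (WithZero.log (Valued.v (ϖ⁻¹ * x))) ↔ ¬ Even (WithZero.log (Valued.v x)) := by
  have hvx : Valued.v x ≠ 0 := (Valuation.ne_zero_iff _).2 hx
  have hvϖ : Valued.v ϖ⁻¹ ≠ 0 := by
    rw [map_inv₀, hϖ, ← WithZero.exp_neg]; exact WithZero.exp_ne_zero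
  rw [map_mul, WithZero.log_mul hvϖ hvx, map_inv₀, hϖ, ← WithZero.exp_neg, WithZero.log_exp, neg_neg, add_comm, Int.even_add_one]

namespace UnitaryGroup

open Literature.NumberTheory.Rogawski1990 Literature.NumberTheory.GaloisRepresentations

section CM

variable (L : Type) [Field L] [NumberField L] [IsCMField L] (v : HeightOneSpectrum (𝓞 ↥(maximalRealSubfield L)))
  (w : PlacesOver L v) (hw : IsCMField.complexConj L • w.1 = w.1)

omit [IsCMField L] in
/-- The inverse of the similitude `d = diag(1, ϖ)` is `diag(1, ϖ⁻¹)` (matrix bookkeeping). [folklore] -/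
private theorem coe_glDiagonal_one_inv (ϖ : (w.1.adicCompletion L)ˣ) :
    (((glDiagonal 2 (w.1.adicCompletion L) ![1, ϖ])⁻¹ : GL (Fin 2) (w.1.adicCompletion L)) : Matrix (Fin 2) (Fin 2) (w.1.adicCompletion L)) =
      diagonal ![(1 : w.1.adicCompletion L), ((ϖ⁻¹ : (w.1.adicCompletion L)ˣ) : w.1.adicCompletion L)] := by
  rw [← map_inv, coe_glDiagonal]
  ext i j
  fin_cases i <;> fin_cases j <;> simp [Matrix.diagonal]

include hw in
set_option maxHeartbeats 400000 in
/-- **KOTTWITZ'S TYPE-(1) ELLIPTIC RELATION `(E)` ON THE CM CARRIER `U₂ = U(Φ₂)(L⁺_v)` (hypothesis form).**  `v` unramified non-split, `w ∣ v` with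
`w̄ = w`, `ϖ ∈ L_w^×` a `σ_w`-fixed uniformiser, `d = diag(1, ϖ)`; `C, C′, I ≤ U₂` ANY subgroups with `u ∈ C ↔ u_w ∈ GL₂(𝒪_w)`,
`u ∈ C′ ↔ u_w ∈ d GL₂(𝒪_w) d⁻¹`, `u ∈ I ↔ u_w ∈ iwahoriGL 2 L_w` (through ★ `localNonsplitEquiv`).  Then for every `γ ∈ U₂` whose one-place image
`γ_w` has an eigenframe `γ_w P = P diag(u₀, u₁)` over `L_w` with `u₀ ≠ u₁` of norm one and `|u₀ − u₁| = |ϖ_v^N|` (TYPE (1), regular elliptic):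
**`#Fix(U₂ ⧸ C, γ) + #Fix(U₂ ⧸ C′, γ) = #Fix(U₂ ⧸ I, γ) + 1`** (`V_K + V_{K′} − E = χ(X^γ) = 1`).  This is the TYPE-(1) case of the binder `hE` of ★
`Rogawski1990.exists_isLocSmooth_classOrbitalIntegral_eq_one_zero_of_relations_two`. [cite: Kottwitz1988, §2 Theorem 2]
[cite: Rogawski1990, §12.6 p. 174; §12.7 Lemma 12.7.1 p. 176] [cite: Serre1980Trees, II.1.1] -/
theorem natCard_fixedBy_add_eq_natCard_fixedBy_add_one_of_eigenframe (hunr : Algebra.IsUnramifiedIn (𝓞 L) v.asIdeal)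
    (ϖ : (w.1.adicCompletion L)ˣ) (hϖ : Valued.v (ϖ : w.1.adicCompletion L) = WithZero.exp (-1 : ℤ))
    (hσϖ : galAdicCompletionMap (L := L) (IsCMField.complexConj L) hw (ϖ : w.1.adicCompletion L) = ϖ)
    (C C' I : Subgroup ((cmDatum L 2 (Matrix.of fun i j : Fin 2 => if i.val + j.val + 1 = 2 then (1 : L) else 0)).Local v))
    (hC : ∀ g, g ∈ C ↔
      ((localNonsplitEquiv (IsCMField.complexConj L) (Matrix.of fun i j : Fin 2 => if i.val + j.val + 1 = 2 then (1 : L) else 0)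
          (IsCMField.complexConj_ne_one L) w hw g :
          unitaryGroupOfForm (galAdicCompletionMap (L := L) (IsCMField.complexConj L) hw)
            (placeForm (Matrix.of fun i j : Fin 2 => if i.val + j.val + 1 = 2 then (1 : L) else 0) w.1)) :
          GL (Fin 2) (w.1.adicCompletion L)) ∈ glInt 2 (w.1.adicCompletion L))
    (hC' : ∀ g, g ∈ C' ↔
      ((localNonsplitEquiv (IsCMField.complexConj L) (Matrix.of fun i j : Fin 2 => if i.val + j.val + 1 = 2 then (1 : L) else 0)
          (IsCMField.complexConj_ne_one L) w hw g :
          unitaryGroupOfForm (galAdicCompletionMap (L := L) (IsCMField.complexConj L) hw)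
            (placeForm (Matrix.of fun i j : Fin 2 => if i.val + j.val + 1 = 2 then (1 : L) else 0) w.1)) :
          GL (Fin 2) (w.1.adicCompletion L)) ∈
        (glInt 2 (w.1.adicCompletion L)).map (MulAut.conj (glDiagonal 2 (w.1.adicCompletion L) ![1, ϖ])).toMonoidHom)
    (hI : ∀ g, g ∈ I ↔
      ((localNonsplitEquiv (IsCMField.complexConj L) (Matrix.of fun i j : Fin 2 => if i.val + j.val + 1 = 2 then (1 : L) else 0)
          (IsCMField.complexConj_ne_one L) w hw g :
          unitaryGroupOfForm (galAdicCompletionMap (L := L) (IsCMField.complexConj L) hw)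
            (placeForm (Matrix.of fun i j : Fin 2 => if i.val + j.val + 1 = 2 then (1 : L) else 0) w.1)) :
          GL (Fin 2) (w.1.adicCompletion L)) ∈ iwahoriGL 2 (w.1.adicCompletion L))
    (γ : (cmDatum L 2 (Matrix.of fun i j : Fin 2 => if i.val + j.val + 1 = 2 then (1 : L) else 0)).Local v)
    {P : GL (Fin 2) (w.1.adicCompletion L)} {u : Fin 2 → w.1.adicCompletion L}
    (hP : (((localNonsplitEquiv (IsCMField.complexConj L) (Matrix.of fun i j : Fin 2 => if i.val + j.val + 1 = 2 then (1 : L) else 0)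
          (IsCMField.complexConj_ne_one L) w hw γ :
          unitaryGroupOfForm (galAdicCompletionMap (L := L) (IsCMField.complexConj L) hw)
            (placeForm (Matrix.of fun i j : Fin 2 => if i.val + j.val + 1 = 2 then (1 : L) else 0) w.1)) :
          GL (Fin 2) (w.1.adicCompletion L)) : Matrix (Fin 2) (Fin 2) (w.1.adicCompletion L)) * P = P * diagonal u)
    (hu : Function.Injective u) (hu1 : ∀ i, galAdicCompletionMap (L := L) (IsCMField.complexConj L) hw (u i) * u i = 1) {N : ℕ}
    (hN : valuation (w.1.adicCompletion L) (u 0 - u 1) =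
      valuation (w.1.adicCompletion L) (toPlace v w (HeckeCharacter.uniformizer ↥(maximalRealSubfield L) v : v.adicCompletion ↥(maximalRealSubfield L)) ^ N)) :
    Nat.card (fixedBy ((cmDatum L 2 (Matrix.of fun i j : Fin 2 => if i.val + j.val + 1 = 2 then (1 : L) else 0)).Local v ⧸ C) γ) +
        Nat.card (fixedBy ((cmDatum L 2 (Matrix.of fun i j : Fin 2 => if i.val + j.val + 1 = 2 then (1 : L) else 0)).Local v ⧸ C') γ) =
      Nat.card (fixedBy ((cmDatum L 2 (Matrix.of fun i j : Fin 2 => if i.val + j.val + 1 = 2 then (1 : L) else 0)).Local v ⧸ I) γ) + 1 := by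
  classical
  have hc1 : IsCMField.complexConj L ≠ 1 := IsCMField.complexConj_ne_one L
  -- the one-place model and the similitude `Ad d`
  set e := localNonsplitEquiv (IsCMField.complexConj L) (Matrix.of fun i j : Fin 2 => if i.val + j.val + 1 = 2 then (1 : L) else 0)
    (IsCMField.complexConj_ne_one L) w hw with he_def
  set T : GL (Fin 2) (w.1.adicCompletion L) := glDiagonal 2 (w.1.adicCompletion L) ![1, ϖ] with hT_def
  have ha : IsUnit (ϖ : w.1.adicCompletion L) := ϖ.isUnit
  have hform := formCongr_glDiagonal_one_eq_smul_placeForm_antidiag L w hw ϖ hσϖ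
  have hJ : placeForm (Matrix.of fun i j : Fin 2 => if i.val + j.val + 1 = 2 then (1 : L) else 0) w.1 = !![(0 : w.1.adicCompletion L), 1; 1, 0] := by
    ext i j; fin_cases i <;> fin_cases j <;> simp [placeForm, Matrix.map_apply]
  have hHd : (placeForm (Matrix.of fun i j : Fin 2 => if i.val + j.val + 1 = 2 then (1 : L) else 0) w.1).det ≠ 0 := by
    rw [hJ]; simp [Matrix.det_fin_two]
  -- (a) the edge count, transported to `U₂ ⧸ I`
  have hE : Nat.card (fixedBy ((cmDatum L 2 (Matrix.of fun i j : Fin 2 => if i.val + j.val + 1 = 2 then (1 : L) else 0)).Local v ⧸ I) γ) =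
      Nat.card (fixedBy (↥(unitaryGroupOfForm (galAdicCompletionMap (L := L) (IsCMField.complexConj L) hw)
          (placeForm (Matrix.of fun i j : Fin 2 => if i.val + j.val + 1 = 2 then (1 : L) else 0) w.1)) ⧸
        (iwahoriGL 2 (w.1.adicCompletion L)).subgroupOf (unitaryGroupOfForm (galAdicCompletionMap (L := L) (IsCMField.complexConj L) hw)
          (placeForm (Matrix.of fun i j : Fin 2 => if i.val + j.val + 1 = 2 then (1 : L) else 0) w.1))) (e γ)) :=
    natCard_fixedBy_quotient_congr I _ e.toMulEquiv (fun g => (hI g).trans Subgroup.mem_subgroupOf.symm) γ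
  have hEsum := natCard_fixedBy_iwahori_add_one_eq_sum_at L v w hw hunr (e γ) hP hu hu1 hN
  -- (b) the self-dual vertex count at `γ_w`
  have hγ : ((e γ : ↥(unitaryGroupOfForm (galAdicCompletionMap (L := L) (IsCMField.complexConj L) hw)
      (placeForm (Matrix.of fun i j : Fin 2 => if i.val + j.val + 1 = 2 then (1 : L) else 0) w.1))) : GL (Fin 2) (w.1.adicCompletion L)) ∈
      Literature.AlgebraicGeometry.ShimuraVarieties.unitaryGroup (galAdicCompletionMap (L := L) (IsCMField.complexConj L) hw)
        (placeForm (Matrix.of fun i j : Fin 2 => if i.val + j.val + 1 = 2 then (1 : L) else 0) w.1) :=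
    Literature.AlgebraicGeometry.ShimuraVarieties.mem_unitaryGroup_iff.2 (mem_unitaryGroupOfForm_iff.1 (e γ).2)
  have hV : Nat.card (fixedBy ((cmDatum L 2 (Matrix.of fun i j : Fin 2 => if i.val + j.val + 1 = 2 then (1 : L) else 0)).Local v ⧸ C) γ) =
      Nat.card (fixedBy (↥(unitaryGroupOfForm (galAdicCompletionMap (L := L) (IsCMField.complexConj L) hw)
          (placeForm (Matrix.of fun i j : Fin 2 => if i.val + j.val + 1 = 2 then (1 : L) else 0) w.1)) ⧸
        (glInt 2 (w.1.adicCompletion L)).subgroupOf (unitaryGroupOfForm (galAdicCompletionMap (L := L) (IsCMField.complexConj L) hw)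
          (placeForm (Matrix.of fun i j : Fin 2 => if i.val + j.val + 1 = 2 then (1 : L) else 0) w.1))) (e γ)) :=
    natCard_fixedBy_quotient_congr C _ e.toMulEquiv (fun g => (hC g).trans Subgroup.mem_subgroupOf.symm) γ
  obtain ⟨e₀, γ₀, he₀, hpar₀, hγ₀, hcount₀⟩ := exists_ncard_selfDualStable_antidiagTwo_eq_zpow_smul_one L v w hw hunr hγ hP hu hu1
  have hVsum₀ := ncard_selfDualStable_zpow_smul_one_eq_sum_at L v w hw hunr hu1 hN he₀ γ₀ hγ₀
  have hV₀ := natCard_fixedBy_glInt_eq_ncard_selfDualStable_at L v w hw hunr (e γ)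
  rw [hcount₀, hVsum₀] at hV₀
  -- (c) the `ϖ`-modular vertex count = the self-dual count at `e_d⁻¹ γ`, whose one-place image `d⁻¹ γ_w d` has the frame `d⁻¹ P`
  have hV' := natCard_fixedBy_quotient_eq_natCard_fixedBy_quotient_cmDatumLocalNonsplitCongr_symm L 2
    (Matrix.of fun i j : Fin 2 => if i.val + j.val + 1 = 2 then (1 : L) else 0) w hw T ha hform (glInt 2 (w.1.adicCompletion L)) C C' hC hC' γ
  set γ₁ := (cmDatumLocalNonsplitCongr L w hw T ha hform).symm γ with hγ₁_def
  have hcoe₁ := coe_localNonsplitEquiv_cmDatumLocalNonsplitCongr_symm L 2 (Matrix.of fun i j : Fin 2 => if i.val + j.val + 1 = 2 then (1 : L) else 0)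
    w hw T ha hform γ
  have hP₁ : (((e γ₁ : ↥(unitaryGroupOfForm (galAdicCompletionMap (L := L) (IsCMField.complexConj L) hw)
      (placeForm (Matrix.of fun i j : Fin 2 => if i.val + j.val + 1 = 2 then (1 : L) else 0) w.1))) : GL (Fin 2) (w.1.adicCompletion L)) :
        Matrix (Fin 2) (Fin 2) (w.1.adicCompletion L)) * ((T⁻¹ * P : GL (Fin 2) (w.1.adicCompletion L)) : Matrix (Fin 2) (Fin 2) (w.1.adicCompletion L)) =
      ((T⁻¹ * P : GL (Fin 2) (w.1.adicCompletion L)) : Matrix (Fin 2) (Fin 2) (w.1.adicCompletion L)) * diagonal u := by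
    rw [hγ₁_def, he_def, hcoe₁, Units.val_mul, Units.val_mul, Units.val_mul, Matrix.mul_assoc, Matrix.mul_assoc, Matrix.mul_assoc,
      Units.mul_inv_cancel_left, ← he_def, hP]
  have hγ₁ : ((e γ₁ : ↥(unitaryGroupOfForm (galAdicCompletionMap (L := L) (IsCMField.complexConj L) hw)
      (placeForm (Matrix.of fun i j : Fin 2 => if i.val + j.val + 1 = 2 then (1 : L) else 0) w.1))) : GL (Fin 2) (w.1.adicCompletion L)) ∈
      Literature.AlgebraicGeometry.ShimuraVarieties.unitaryGroup (galAdicCompletionMap (L := L) (IsCMField.complexConj L) hw)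
        (placeForm (Matrix.of fun i j : Fin 2 => if i.val + j.val + 1 = 2 then (1 : L) else 0) w.1) :=
    Literature.AlgebraicGeometry.ShimuraVarieties.mem_unitaryGroup_iff.2 (mem_unitaryGroupOfForm_iff.1 (e γ₁).2)
  have hV₁' : Nat.card (fixedBy ((cmDatum L 2 (Matrix.of fun i j : Fin 2 => if i.val + j.val + 1 = 2 then (1 : L) else 0)).Local v ⧸ C) γ₁) =
      Nat.card (fixedBy (↥(unitaryGroupOfForm (galAdicCompletionMap (L := L) (IsCMField.complexConj L) hw)
          (placeForm (Matrix.of fun i j : Fin 2 => if i.val + j.val + 1 = 2 then (1 : L) else 0) w.1)) ⧸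
        (glInt 2 (w.1.adicCompletion L)).subgroupOf (unitaryGroupOfForm (galAdicCompletionMap (L := L) (IsCMField.complexConj L) hw)
          (placeForm (Matrix.of fun i j : Fin 2 => if i.val + j.val + 1 = 2 then (1 : L) else 0) w.1))) (e γ₁)) :=
    natCard_fixedBy_quotient_congr C _ e.toMulEquiv (fun g => (hC g).trans Subgroup.mem_subgroupOf.symm) γ₁
  obtain ⟨e₁, γ₁', he₁, hpar₁, hγ₁', hcount₁⟩ := exists_ncard_selfDualStable_antidiagTwo_eq_zpow_smul_one L v w hw hunr hγ₁ hP₁ hu hu1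
  have hVsum₁ := ncard_selfDualStable_zpow_smul_one_eq_sum_at L v w hw hunr hu1 hN he₁ γ₁' hγ₁'
  have hV₁ := natCard_fixedBy_glInt_eq_ncard_selfDualStable_at L v w hw hunr (e γ₁)
  rw [hcount₁, hVsum₁] at hV₁
  -- (d) THE PARITY FLIP `e₁ = 1 − e₀`: `⟨d⁻¹p₀, d⁻¹p₀⟩ = ϖ⁻¹ ⟨p₀, p₀⟩`
  have hd : ∀ i, galAdicCompletionMap (L := L) (IsCMField.complexConj L) hw
      ((![(1 : w.1.adicCompletion L), ((ϖ⁻¹ : (w.1.adicCompletion L)ˣ) : w.1.adicCompletion L)]) i) =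
      (![(1 : w.1.adicCompletion L), ((ϖ⁻¹ : (w.1.adicCompletion L)ˣ) : w.1.adicCompletion L)]) i := by
    intro i
    fin_cases i
    · simp
    · simp [Units.val_inv_eq_inv_val, map_inv₀, hσϖ]
  have hentry : twistGram (galAdicCompletionMap (L := L) (IsCMField.complexConj L) hw)
      (placeForm (Matrix.of fun i j : Fin 2 => if i.val + j.val + 1 = 2 then (1 : L) else 0) w.1)
      ((T⁻¹ * P : GL (Fin 2) (w.1.adicCompletion L))).val 0 0 =
      (ϖ : w.1.adicCompletion L)⁻¹ * twistGram (galAdicCompletionMap (L := L) (IsCMField.complexConj L) hw)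
        (placeForm (Matrix.of fun i j : Fin 2 => if i.val + j.val + 1 = 2 then (1 : L) else 0) w.1) P.val 0 0 := by
    rw [Units.val_mul, hT_def, coe_glDiagonal_one_inv L v w ϖ, hJ,
      twistGram_antidiag_diagonal_mul_apply_zero_zero _ _ hd]
    simp [Units.val_inv_eq_inv_val]
  have hne : twistGram (galAdicCompletionMap (L := L) (IsCMField.complexConj L) hw)
      (placeForm (Matrix.of fun i j : Fin 2 => if i.val + j.val + 1 = 2 then (1 : L) else 0) w.1) P.val 0 0 ≠ 0 :=
    twistGram_eigenframe_apply_ne_zero _ _ hHd hγ hP hu hu1 0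
  have hflip : (e₁ = 0) ↔ ¬ (e₀ = 0) := by
    rw [← hpar₁, ← hpar₀, hentry]
    exact even_log_valued_inv_mul_iff hϖ hne
  have he₁e₀ : e₁ = 1 - e₀ := by omega
  -- (e) assemble
  rw [hV, hV₀, hV', hV₁', hV₁, he₁e₀, sum_filter_mod_two_add_sum_filter_one_sub_eq _ he₀, hE, hEsum]

end CM

end UnitaryGroup

end Literature.NumberTheory.Automorphic

end
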